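import Summits.Ventures.LatticeQCDFlow.Exactness.Phi4FlowSquareIntegrableAcceptanceCeiling
import HarnessLib

/-!
# The target-mean INVERSE acceptance of the exact flow sampler is the inverse Kish fraction within a
# factor two: `1/κ ≤ E_π[1/ρ] ≤ 2/κ`, i.e. `W₂/Z − Z ≤ ∫ w r/(1−r) ≤ 2W₂/Z − Z`, for EVERY flow with `W₂ < ∞`

HONEST FRAMING: exact (Metropolis-corrected) sampling algorithms for lattice gauge theory;
figures of merit are autocorrelation/cost numbers at stated couplings and volumes; no
continuum-physics claim.  (SCALAR calibration rung S0-A: not a gauge result.)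

Venture `LatticeQCDFlow` (cell pub-lqcd), topic `Exactness`; FANOUT row 2 (`s0-phi4`, FLOW arm).
NEW WORK of the cell (two integrations of the tree's pointwise pinning of the per-state acceptance;
nothing is cited as a fact; no definition).  Setting (general `(X, μ)`): target weight `w > 0`
(`Z = ∫ w`), flow `q̃ > 0` with `∫ q̃ = 1`, `b = w/q̃`, `W₂ = ∫ b w < ∞`, `κ = Z²/W₂` the Kish
fraction; `r(x) = ∫ (1 − α(x, ·)) q̃` the rejection probability of `imhOp μ w q̃` from `x` and
`ρ = 1 − r` the per-state acceptance.  The tree pins `ρ` pointwise between the weight and the Kish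
scale: `b/Z − 1 ≤ r/(1−r)` (`rejOdds_ge`, row 2) and `ρ ≥ Z²/(W₂ + bZ)` (`one_sub_rejCurve_ge`,
`IMHAcceptanceGeHalfESS` — Deligiannidis–Lee 2018 §3.1 Cor. 2 NAMED there).  Integrated against the
TARGET these give the two-sided law of this file,

  **`W₂/Z − Z ≤ ∫ w · r/(1 − r) dμ ≤ 2W₂/Z − Z`**, equivalently **`1/κ ≤ E_π[1/ρ] ≤ 2/κ`**,

the quantity that IS the integrated autocorrelation time of every weight-blind observable
(`FlowSamplerWeightBlindObservables.tauInt_weightBlind_eq`: `τ_int = E_π[1/ρ] − ½`, same session) and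
that enters the sticking floor of every observable (`τ_int(g) ≥ ½ + E_{g²}[r/(1−r)]`, row 2).  The
tree's `IMHAcceptanceGeHalfESS` bounds the ARITHMETIC target mean `E_π[ρ] ≥ κ/2`; here the harmonic
side, which is the one autocorrelations see.  Rows 3/8 typed the FINITE product-space version
(`Scoring/IMHWeightBlindTau*`, `blind_tauInt_mem_Icc_essFrac`); this is the general-space form.

## What is proved

* **`weight_odds_bounds`** — `w, q̃ > 0` measurable integrable, `∫ q̃ = 1`, `b w ∈ L¹`:
  `w · r/(1−r) ∈ L¹`, `W₂/Z − Z ≤ ∫ w r/(1−r) ≤ 2W₂/Z − Z`;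
* **`integral_weight_div_acc_bounds`** — the same as `W₂/Z ≤ ∫ w/(1 − r) ≤ 2W₂/Z`
  (`1/κ ≤ E_π[1/ρ] ≤ 2/κ` after division by `Z`);
* lattice φ⁴ (`λ > 0`, real `J`, any flow with `∫ e^{−2S}/q̃ < ∞`): **`phi4Flow_weight_odds_bounds`**.

Reading for S0-A (no numerics implied): for weight-blind observables the chain's `τ_int` is `1/κ`
within a factor two, so on that class 'ESS per cost' and 'τ_int per cost' certify each other; the
unbounded discrepancies between the chain and reweighting (`FlowSamplerVsReweightingWitness`,
`FlowSamplerKishFractionScope`) need observables correlated with the weight.  NOT CLAIMED: anything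
when `W₂ = ∞` (then `E_π[1/ρ] = ∞` by the lower bound's proof, not typed); values for any run.
-/

namespace Summit.Ventures.LatticeQCDFlow.Exactness

open Real MeasureTheory Filter Set
open Summit.Ventures.LatticeQCDFlow.Scoring

section General

variable {X : Type*} [MeasurableSpace X] {μ : Measure X} [SFinite μ] {w q : X → ℝ}

/-- **THE TARGET-MEAN REJECTION ODDS IS PINNED BY THE KISH FRACTION**: under `W₂ = ∫ b w < ∞`,
`w r/(1−r) ∈ L¹` and `W₂/Z − Z ≤ ∫ w r/(1 − r) ≤ 2W₂/Z − Z`, i.e. `1/κ ≤ E_π[1/ρ] ≤ 2/κ`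
(`b/Z ≤ 1/ρ ≤ (W₂ + bZ)/Z²`: the tree's `rejOdds_ge` and `one_sub_rejCurve_ge`). -/
theorem weight_odds_bounds (hw0 : ∀ t, 0 < w t) (hwm : Measurable w) (hwi : Integrable w μ)
    (hq0 : ∀ t, 0 < q t) (hqm : Measurable q) (hqi : Integrable q μ) (hq1 : ∫ z, q z ∂μ = 1)
    (hW₂ : Integrable (fun x => w x / q x * w x) μ) :
    Integrable (fun t => w t * ((∫ t', (1 - imhAcceptQ w q t t') * q t' ∂μ)
      / (1 - ∫ t', (1 - imhAcceptQ w q t t') * q t' ∂μ))) μ ∧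
    (∫ x, w x / q x * w x ∂μ) / (∫ t, w t ∂μ) - ∫ t, w t ∂μ
      ≤ ∫ t, w t * ((∫ t', (1 - imhAcceptQ w q t t') * q t' ∂μ)
          / (1 - ∫ t', (1 - imhAcceptQ w q t t') * q t' ∂μ)) ∂μ ∧
    ∫ t, w t * ((∫ t', (1 - imhAcceptQ w q t t') * q t' ∂μ)
          / (1 - ∫ t', (1 - imhAcceptQ w q t t') * q t' ∂μ)) ∂μ
      ≤ 2 * (∫ x, w x / q x * w x ∂μ) / (∫ t, w t ∂μ) - ∫ t, w t ∂μ := by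
  obtain ⟨hr0, hr1, hrm⟩ := rejection_bounds (μ := μ) hw0 hwm hq0 hqm hqi hq1
  set r : X → ℝ := fun t => ∫ t', (1 - imhAcceptQ w q t t') * q t' ∂μ with hr
  set Z : ℝ := ∫ t, w t ∂μ with hZdef
  set W : ℝ := ∫ x, w x / q x * w x ∂μ with hWdef
  have hZ : 0 < Z := integral_pos_of_pos hw0 hwi hq1
  have hW0 : 0 ≤ W := integral_nonneg fun x => mul_nonneg (div_pos (hw0 x) (hq0 x)).le (hw0 x).le
  have hrlt : ∀ t, r t < 1 := fun t => by
    show (∫ t', (1 - imhAcceptQ w q t t') * q t' ∂μ) < 1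
    rw [rejection_eq_rejCurve hw0 hq0 t]
    exact rejCurve_lt_one hw0 hwm hq0 hqm hqi hq1 (div_pos (hw0 t) (hq0 t))
  -- pointwise pinning of the odds
  have hlow : ∀ t, w t / q t / Z - 1 ≤ r t / (1 - r t) := fun t => by
    have h := rejOdds_ge hw0 hwm hwi hq0 hqm hqi hq1 (div_pos (hw0 t) (hq0 t))
    rw [← rejection_eq_rejCurve hw0 hq0 t] at h
    exact h
  have hup : ∀ t, r t / (1 - r t) ≤ W / Z ^ 2 + w t / q t / Z - 1 := fun t => by
    have hρ := one_sub_rejCurve_ge hw0 hwm hwi hq0 hqm hqi hq1 hW₂ (div_pos (hw0 t) (hq0 t))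
    rw [← rejection_eq_rejCurve hw0 hq0 t, ← hZdef, ← hWdef] at hρ
    have h1 : 0 < 1 - r t := sub_pos.2 (hrlt t)
    have hden : 0 < W + w t / q t * Z := add_pos_of_nonneg_of_pos hW0 (mul_pos (div_pos (hw0 t) (hq0 t)) hZ)
    -- `1/(1−r) ≤ (W + bZ)/Z²`
    have h2 : 1 / (1 - r t) ≤ (W + w t / q t * Z) / Z ^ 2 := by
      rw [div_le_div_iff₀ h1 (pow_pos hZ 2), one_mul]
      have := (div_le_iff₀ hden).1 hρ
      linarith
    have e : r t / (1 - r t) = 1 / (1 - r t) - 1 := by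
      field_simp
      ring
    rw [e]
    have e2 : (W + w t / q t * Z) / Z ^ 2 = W / Z ^ 2 + w t / q t / Z := by
      field_simp
    linarith [e2]
  have hodds0 : ∀ t, 0 ≤ r t / (1 - r t) := fun t => div_nonneg (hr0 t) (sub_pos.2 (hrlt t)).le
  -- integrability by domination
  have hdom : Integrable (fun t => W / Z ^ 2 * w t + 1 / Z * (w t / q t * w t)) μ :=
    (hwi.const_mul _).add (hW₂.const_mul _)
  have hint : Integrable (fun t => w t * (r t / (1 - r t))) μ := by
    refine Integrable.mono' hdom (hwm.mul (hrm.div (measurable_const.sub hrm))).aestronglyMeasurable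
      (Eventually.of_forall fun t => ?_)
    rw [Real.norm_eq_abs, abs_of_nonneg (mul_nonneg (hw0 t).le (hodds0 t))]
    have h := mul_le_mul_of_nonneg_left (hup t) (hw0 t).le
    have hw := hw0 t
    have e : w t * (W / Z ^ 2 + w t / q t / Z - 1) = W / Z ^ 2 * w t + 1 / Z * (w t / q t * w t) - w t := by
      ring
    linarith
  refine ⟨hint, ?_, ?_⟩
  · -- lower: `∫ w (b/Z − 1) = W/Z − Z`
    have hlowint : Integrable (fun t => 1 / Z * (w t / q t * w t) - w t) μ := (hW₂.const_mul _).sub hwi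
    have h := integral_mono hlowint hint fun t => by
      have := mul_le_mul_of_nonneg_left (hlow t) (hw0 t).le
      have e : w t * (w t / q t / Z - 1) = 1 / Z * (w t / q t * w t) - w t := by ring
      linarith
    rw [integral_sub (hW₂.const_mul _) hwi, integral_const_mul] at h
    have e : 1 / Z * W - Z = W / Z - Z := by ring
    linarith
  · have h := integral_mono hint (hdom.sub' hwi) fun t => by
      have := mul_le_mul_of_nonneg_left (hup t) (hw0 t).le
      have e : w t * (W / Z ^ 2 + w t / q t / Z - 1)
          = W / Z ^ 2 * w t + 1 / Z * (w t / q t * w t) - w t := by ring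
      show w t * (r t / (1 - r t)) ≤ (W / Z ^ 2 * w t + 1 / Z * (w t / q t * w t)) - w t
      linarith
    rw [integral_sub hdom hwi, integral_add (hwi.const_mul _) (hW₂.const_mul _), integral_const_mul,
      integral_const_mul] at h
    have e : W / Z ^ 2 * Z + 1 / Z * W - Z = 2 * W / Z - Z := by field_simp; ring
    linarith

/-- **`1/κ ≤ E_π[1/ρ] ≤ 2/κ`** in the form `W₂/Z ≤ ∫ w/(1 − r) ≤ 2 W₂/Z` (`1/(1−r) = 1 + r/(1−r)`). -/
theorem integral_weight_div_acc_bounds (hw0 : ∀ t, 0 < w t) (hwm : Measurable w)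
    (hwi : Integrable w μ) (hq0 : ∀ t, 0 < q t) (hqm : Measurable q) (hqi : Integrable q μ)
    (hq1 : ∫ z, q z ∂μ = 1) (hW₂ : Integrable (fun x => w x / q x * w x) μ) :
    Integrable (fun t => w t / (1 - ∫ t', (1 - imhAcceptQ w q t t') * q t' ∂μ)) μ ∧
    (∫ x, w x / q x * w x ∂μ) / (∫ t, w t ∂μ)
      ≤ ∫ t, w t / (1 - ∫ t', (1 - imhAcceptQ w q t t') * q t' ∂μ) ∂μ ∧
    ∫ t, w t / (1 - ∫ t', (1 - imhAcceptQ w q t t') * q t' ∂μ) ∂μ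
      ≤ 2 * (∫ x, w x / q x * w x ∂μ) / (∫ t, w t ∂μ) := by
  obtain ⟨hint, hlo, hhi⟩ := weight_odds_bounds hw0 hwm hwi hq0 hqm hqi hq1 hW₂
  set r : X → ℝ := fun t => ∫ t', (1 - imhAcceptQ w q t t') * q t' ∂μ with hr
  have hrlt : ∀ t, r t < 1 := fun t => by
    show (∫ t', (1 - imhAcceptQ w q t t') * q t' ∂μ) < 1
    rw [rejection_eq_rejCurve hw0 hq0 t]
    exact rejCurve_lt_one hw0 hwm hq0 hqm hqi hq1 (div_pos (hw0 t) (hq0 t))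
  -- `w/(1−r) = w + w·r/(1−r)`
  have e : ∀ t, w t / (1 - r t) = w t + w t * (r t / (1 - r t)) := fun t => by
    have h1 : 1 - r t ≠ 0 := (sub_pos.2 (hrlt t)).ne'
    field_simp
    ring
  have hfun : (fun t => w t / (1 - r t)) = fun t => w t + w t * (r t / (1 - r t)) := funext e
  refine ⟨by rw [hfun]; exact hwi.add hint, ?_, ?_⟩
  · rw [hfun, integral_add hwi hint]
    linarith
  · rw [hfun, integral_add hwi hint]
    linarith

end General

/-! ## Lattice φ⁴ (`λ > 0`, real `J`, any flow with a finite second weight moment) -/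

section Lattice

variable {n : ℕ}

/-- **For lattice φ⁴ and ANY flow `q̃` with `∫ e^{−2S}/q̃ < ∞`**: the Gibbs-mean rejection odds of the
exact flow sampler satisfies `W₂/Z − Z ≤ ∫ e^{−S} r/(1−r) ≤ 2W₂/Z − Z` (`W₂ = ∫ (e^{−S}/q̃) e^{−S}`,
`Z = gibbsZ`): `1/κ ≤ ⟨1/ρ⟩ ≤ 2/κ`. -/
theorem phi4Flow_weight_odds_bounds {lam : ℝ} (hlam : 0 < lam)
    (J : Fin (n + 1) → Fin (n + 1) → ℝ) {q : (Fin (n + 1) → ℝ) → ℝ} (hq0 : ∀ φ, 0 < q φ)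
    (hqm : Measurable q) (hqi : Integrable q) (hq1 : ∫ φ, q φ = 1)
    (hW₂ : Integrable (fun φ => gibbsWeight J lam φ / q φ * gibbsWeight J lam φ)) :
    Integrable (fun φ => gibbsWeight J lam φ
      * ((∫ φ', (1 - imhAcceptQ (gibbsWeight J lam) q φ φ') * q φ')
        / (1 - ∫ φ', (1 - imhAcceptQ (gibbsWeight J lam) q φ φ') * q φ'))) ∧
    (∫ φ, gibbsWeight J lam φ / q φ * gibbsWeight J lam φ) / gibbsZ J lam - gibbsZ J lam
      ≤ ∫ φ, gibbsWeight J lam φ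
          * ((∫ φ', (1 - imhAcceptQ (gibbsWeight J lam) q φ φ') * q φ')
            / (1 - ∫ φ', (1 - imhAcceptQ (gibbsWeight J lam) q φ φ') * q φ')) ∧
    ∫ φ, gibbsWeight J lam φ
          * ((∫ φ', (1 - imhAcceptQ (gibbsWeight J lam) q φ φ') * q φ')
            / (1 - ∫ φ', (1 - imhAcceptQ (gibbsWeight J lam) q φ φ') * q φ'))
      ≤ 2 * (∫ φ, gibbsWeight J lam φ / q φ * gibbsWeight J lam φ) / gibbsZ J lam - gibbsZ J lam :=
  weight_odds_bounds (μ := volume) (fun φ => gibbsWeight_pos J lam φ)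
    (continuous_gibbsWeight J lam).measurable (integrable_gibbsWeight hlam J) hq0 hqm hqi hq1 hW₂

end Lattice

end Summit.Ventures.LatticeQCDFlow.Exactness
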